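/-
Copyright (c) 2026 the pub-hodgecm-mathlib formalisation cell (harness21).  Prover seat hodgecm-mathlib-LH4-p06 (g3): Track A «(D-RAM) FOUR-FRAME» squad of crux H413, unit
U3_Laws, (KMS) road «MODULO κ-STAGE B», brick κB-H₂ «CORE-HANGING κ-SOCKETS, TYPE 2» FILE (W) «THE WINDOW AT CORNER DEPTH e» (dealer LH4-plan (g11) WORD #51), 2026-09-04.
-/
import Summits.HodgeConjecture.HodgeConjecture.Theorems.F0P3cDyRamDiagonalKappaCoreHangingClass        -- ★ p856713 FILE (A2) (this seat): the `e = 0` window, `chiVec_apply`, `two_le_d_of_v_two_lt_one`; brings ★ Fκ2, ★ toolkit p856540, ★ `normSign_mul_self`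
import Summits.HodgeConjecture.HodgeConjecture.Theorems.F0P3cDyRamDiagonalGluedStabiliserIndexCorner   -- ★ p856076 (LH4-p08 (g2)): `mem_fixedUnitStabilizer_latt_glued_corner_iff` (`S_F` of the frame with corner depth `e`)
import HarnessLib

/-!
# Crux `H413`, (KMS) ROAD «MODULO κ-STAGE B», brick κB-H₂ FILE (W): THE ALIVE ∕ DEAD WINDOW OF `χ_i` ON `S_F` OF A CORE-HANGING LATTICE WITH CORNER DEPTH `e`
# (letter `LETTER-kappaBH-tv2.v1.LH4p06g3.md` 44d44a13 §2)

Cell `hodgecm-mathlib` (D-0151), FLOOR 0, crux item H413 = `stmt-HodgeConjecture-24833`; lane `--supports stmt-HodgeConjecture-24833 --as helper` (count-neutral).  THEOREMS ONLY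
(no `def`, no instance, no notation, no `sorry`, default heartbeats).

THE MATHEMATICS.  For the frame `V = (1 0 0; x ϖ^ρ 0; xζ+f·xζ ϖ^ρζ ϖ^{2ρ+e})` (`x, ζ` units, `f` a fixed unit with `|1+f| = 1`; `e = 0` the type-0 stratum of ★ FILE (A2), `e = 1` the type-2
frame of ★ p07 (g4)'s B7₂ chain) the σ-fixed unit diagonal stabiliser is `S_F = {u ∈ 𝒰 : |u₂ − u₁| ≤ |ϖ|^{ρ+e}, |f⁻¹(u₂−u₁) + (u₂−u₀)| ≤ |ϖ|^{2ρ+e}}`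
(★ `mem_fixedUnitStabilizer_latt_glued_corner_iff` at `s = 0`); so every pair ratio of a stabilising fixed unit lies in `U_E(ρ+e)`, and
* ALIVE `chiVec_eq_one_of_mem_fixedUnitStabilizer_corner`: `2d−1 ≤ ρ+e ⟹ χ_i ≡ 1 on S_F` (toolkit §3 `normSign_eq_of_near`);
* DEAD `exists_mem_fixedUnitStabilizer_chiVec_ne_one_corner`: `ρ+e ≤ 2d−2 ⟹ ∃ u ∈ S_F, χ_i(u) ≠ 1` for each slot (the break-level non-norm `c` of toolkit §2, witnesses as at
  `e = 0` — the second congruence is solved exactly).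
At `e = 1`: alive ⟺ `ρ ≥ 2d−2` — one level more than at type 0; FILES (S)∕(C) show that the extra level `ρ = 2d−2` nevertheless carries κ-count `0`.  The proofs are ★ FILE (A2) §3
verbatim with `ρ+e` for `ρ` in the congruence depths.
HONEST LABEL.  Count-neutral; `HC_CM` is proved only modulo the 7 printed citations (2 remaining named inputs: hLiu418 = `stmt-HodgeConjecture-24832`, h413 = `stmt-HodgeConjecture-24833`)
until rung 0 closes.

## References
* [Kottwitz1986BaseChangeUnits] R. Kottwitz, *Base change for unit elements of Hecke algebras*, Compositio Math. 60 (1986), §1 pp. 240–241 (κ-orbital integrals as signed lattice counts).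
* [Rogawski1990] J. D. Rogawski, *Automorphic Representations of Unitary Groups in Three Variables*, Ann. of Math. Stud. 123 (1990), §4.10 p. 58.
* [Serre1979] J.-P. Serre, *Local Fields*, GTM 67 (1979), Ch. V §3 Cor. 3 (p. 85), Ch. XV §2 (the norm groups and the conductor of the quadratic character).
-/

set_option autoImplicit false

noncomputable section

namespace Summit.HodgeConjecture.HodgeConjecture.Cruxes.H413.F0P3cDyRamDiagonalKappaCoreHangingCornerWindow

open Matrix WithZero
open Literature.NumberTheory.Automorphic Literature.NumberTheory.Automorphic.HermitianLattice Literature.NumberTheory.Automorphic.UnitaryGroup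
open Literature.NumberTheory.Automorphic.UnitaryLatticeTree Literature.NumberTheory.Automorphic.UnitaryThreeFourFrame
open Literature.NumberTheory.LocalFields.WildQuadraticDatum
open Summit.HodgeConjecture.HodgeConjecture.Cruxes.H413.F0P3cDyRamDiagonalTorusDefs
open Summit.HodgeConjecture.HodgeConjecture.Cruxes.H413.F0P3cDyRamDiagonalGluedStabiliserIndexCorner
open Summit.HodgeConjecture.HodgeConjecture.Cruxes.H413.F0P3cDyRamDiagonalKappaCountDefs
open Summit.HodgeConjecture.HodgeConjecture.Cruxes.H413.F0P3cDyRamDiagonalKappaCountEval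
open Summit.HodgeConjecture.HodgeConjecture.Cruxes.H413.F0P3cDyRamDiagonalKappaSplitCountEval (normSign_mul_self)
open Summit.HodgeConjecture.HodgeConjecture.Cruxes.H413.F0P3cDyRamDiagonalKappaCoreHangingClass (chiVec_apply)
open scoped Valued WithZero Matrix MatrixGroups

variable {K : Type} [Field K] [Valued K ℤᵐ⁰]

/-- **ALIVE** (corner depth `e`): if `2d−1 ≤ ρ+e` then `χ_i ≡ 1` on `S_F` of the core-hanging lattice `latt (1 0 0; x ϖ^ρ 0; xζ+f·xζ ϖ^ρζ ϖ^{2ρ+e})` (all three pair ratios of a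
stabilising fixed unit lie in `U_E(ρ+e) ⊆ N(Kˣ)`, toolkit §3; `e = 0` is ★ FILE (A2)'s type-0 window, `e = 1` the type-2 frame).
[cite: Serre1979, Ch. XV §2] [cite: Kottwitz1986BaseChangeUnits, §1 pp. 240–241] -/
theorem chiVec_eq_one_of_mem_fixedUnitStabilizer_corner [CompleteSpace K] {σ : K →+* K} {ϖ : K} {d t : ℕ} (hD : IsRamifiedQuadraticDatum σ ϖ d t)
    (ρ e : ℕ) {x ζ f : K} (hx : Valued.v x = 1) (hζ : Valued.v ζ = 1) (hf : Valued.v f = 1)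
    (V : GL (Fin 3) K) (hV : (V : Matrix (Fin 3) (Fin 3) K) = !![1, 0, 0; x, ϖ ^ ρ, 0; x * ζ + f * (x * ζ), ϖ ^ ρ * ζ, ϖ ^ (2 * ρ + e)])
    (hρ : 2 * d - 1 ≤ ρ + e) {u : Fin 3 → Kˣ} (hu : u ∈ fixedUnitStabilizer σ (latt (V : Matrix (Fin 3) (Fin 3) K))) (i : Fin 3) :
    chiVec σ i (fun j => ((u j : Kˣ) : K)) = 1 := by
  obtain ⟨hσ, hvσ, hϖ, hfix, hd, hd1, ht⟩ := id hD
  have hϖ0 : ϖ ≠ 0 := fun h => by rw [h, map_zero] at hϖ; exact (exp_ne_zero hϖ.symm).elim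
  have hϖ1 : Valued.v ϖ ≤ 1 := by rw [hϖ, ← exp_zero, exp_le_exp]; norm_num
  have hf0 : f ≠ 0 := fun h => by rw [h, map_zero] at hf; exact zero_ne_one hf
  have huT : u ∈ fixedUnitTorus σ 3 := hu.2
  have hufix : ∀ j, σ ((u j : Kˣ) : K) = u j := fun j => ((mem_fixedUnitTorus_iff σ u).1 huT).2 j
  have huv : ∀ j, Valued.v ((u j : Kˣ) : K) = 1 := fun j => ((mem_fixedUnitTorus_iff σ u).1 huT).1 j
  -- the membership letters (★ corner lemma at `s = 0`, corner depth `e`, lineariser `g = 1∕f`)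
  have hV0 : (V : Matrix (Fin 3) (Fin 3) K) = !![1, 0, 0; x, ϖ ^ ρ, 0; x * ζ + f * (x * ζ), ϖ ^ ρ * ζ, ϖ ^ (2 * ρ + 0 + e)] := by rw [Nat.add_zero]; exact hV
  have hmem := (mem_fixedUnitStabilizer_latt_glued_corner_iff (σ := σ) hϖ0 hϖ1 ρ 0 e (x := x) (ζ := ζ) (y'' := f * (x * ζ)) (g := f⁻¹) hx hζ
    (by rw [pow_zero, map_mul, map_mul, hf, hx, hζ, one_mul, one_mul]) (by rw [pow_zero, mul_one, map_inv₀, hf, inv_one])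
    (by rw [show x * ζ - f⁻¹ * (f * (x * ζ)) = 0 by rw [← mul_assoc, inv_mul_cancel₀ hf0, one_mul, sub_self], map_zero]; exact zero_le) V hV0 huT).1 hu
  obtain ⟨h21, h20⟩ := hmem
  rw [Nat.add_zero] at h21
  -- all pairs are `(ρ+e)`-close
  have hpow2 : Valued.v ϖ ^ (2 * ρ + e) ≤ Valued.v ϖ ^ (ρ + e) := pow_le_pow_right_of_le_one' hϖ1 (by omega)
  have h20' : Valued.v (((u 2 : Kˣ) : K) - u 0) ≤ Valued.v ϖ ^ (ρ + e) := by
    have e : ((u 2 : Kˣ) : K) - u 0 = (f⁻¹ * (((u 2 : Kˣ) : K) - u 1) + (((u 2 : Kˣ) : K) - u 0)) + -(f⁻¹ * (((u 2 : Kˣ) : K) - u 1)) := by ring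
    rw [e]
    refine (Valuation.map_add _ _ _).trans (max_le (h20.trans hpow2) ?_)
    rw [Valuation.map_neg, map_mul, map_inv₀, hf, inv_one, one_mul]; exact h21
  have h10 : Valued.v (((u 1 : Kˣ) : K) - u 0) ≤ Valued.v ϖ ^ (ρ + e) := by
    have e : ((u 1 : Kˣ) : K) - u 0 = (((u 2 : Kˣ) : K) - u 0) + -(((u 2 : Kˣ) : K) - u 1) := by ring
    rw [e]
    exact (Valuation.map_add _ _ _).trans (max_le h20' (by rw [Valuation.map_neg]; exact h21))
  -- hence all three `ω` agree
  have hω21 : normSign σ ((u 1 : Kˣ) : K) = normSign σ ((u 2 : Kˣ) : K) := normSign_eq_of_near hD (hufix 2) (hufix 1) (huv 2) hρ h21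
  have hω20 : normSign σ ((u 0 : Kˣ) : K) = normSign σ ((u 2 : Kˣ) : K) := normSign_eq_of_near hD (hufix 2) (hufix 0) (huv 2) hρ h20'
  rw [chiVec_apply]
  fin_cases i
  · simp only [Fin.zero_eta, cons_val_zero]; rw [hω21]; exact normSign_mul_self σ _
  · simp only [Fin.mk_one, cons_val_one, cons_val_zero]; rw [hω20]; exact normSign_mul_self σ _
  · simp only [Fin.reduceFinMk, cons_val_two, Nat.succ_eq_add_one, Nat.reduceAdd, tail_cons, head_cons]
    rw [hω20, hω21]; exact normSign_mul_self σ _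

/-- **DEAD** (corner depth `e`): if `ρ+e ≤ 2d−2` (and `|2| < 1`) then for each slot `i` some `u ∈ S_F` has `χ_i(u) ≠ 1` (witnesses built from the break-level non-norm `c`,
toolkit §2, with `|c − 1| ≤ |ϖ|^{ρ+e}`; the second stabiliser congruence is solved EXACTLY, so the corner depth costs nothing; the slot `i = 2` uses `|1 + f| = 1`).
[cite: Serre1979, Ch. V §3 Cor. 3] [cite: Kottwitz1986BaseChangeUnits, §1 pp. 240–241] -/
theorem exists_mem_fixedUnitStabilizer_chiVec_ne_one_corner [CompleteSpace K] [Finite 𝓀[K]] {σ : K →+* K} {ϖ : K} {d t : ℕ}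
    (hD : IsRamifiedQuadraticDatum σ ϖ d t) (h2 : Valued.v (2 : K) < 1)
    (ρ e : ℕ) {x ζ f : K} (hx : Valued.v x = 1) (hζ : Valued.v ζ = 1) (hσf : σ f = f) (hf : Valued.v f = 1) (h1f : Valued.v (1 + f) = 1)
    (V : GL (Fin 3) K) (hV : (V : Matrix (Fin 3) (Fin 3) K) = !![1, 0, 0; x, ϖ ^ ρ, 0; x * ζ + f * (x * ζ), ϖ ^ ρ * ζ, ϖ ^ (2 * ρ + e)])
    (hρ : ρ + e ≤ 2 * d - 2) (i : Fin 3) :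
    ∃ u ∈ fixedUnitStabilizer σ (latt (V : Matrix (Fin 3) (Fin 3) K)), chiVec σ i (fun j => ((u j : Kˣ) : K)) ≠ 1 := by
  obtain ⟨hσ, hvσ, hϖ, hfix, hd, hd1, ht⟩ := id hD
  have hϖ0 : ϖ ≠ 0 := fun h => by rw [h, map_zero] at hϖ; exact (exp_ne_zero hϖ.symm).elim
  have hϖ1 : Valued.v ϖ ≤ 1 := by rw [hϖ, ← exp_zero, exp_le_exp]; norm_num
  have hf0 : f ≠ 0 := fun h => by rw [h, map_zero] at hf; exact zero_ne_one hf
  have hd2 : 2 ≤ d := F0P3cDyRamDiagonalKappaCoreHangingClass.two_le_d_of_v_two_lt_one hD h2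
  -- the break-level non-norm `c`, `|c − 1| ≤ |ϖ|^{ρ+e}`, `|c − 1| < 1`
  obtain ⟨c, hσc, hc1, hcd, hcn⟩ := exists_fixed_unit_not_norm_v_sub_one_le hD h2
  have hc0 : c ≠ 0 := fun h => by rw [h, map_zero] at hc1; exact zero_ne_one hc1
  have hcρ : Valued.v (c - 1) ≤ Valued.v ϖ ^ (ρ + e) := by
    refine hcd.trans ?_
    rw [v_varpi_pow hϖ, exp_le_exp]; omega
  have hc1ρ : Valued.v (1 - c) ≤ Valued.v ϖ ^ (ρ + e) := by rw [← neg_sub, Valuation.map_neg]; exact hcρ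
  have hclt : Valued.v (1 - c) < 1 := by
    rw [← neg_sub, Valuation.map_neg]
    refine hcd.trans_lt ?_
    rw [← exp_zero, exp_lt_exp]; omega
  have hωc : normSign σ c = -1 := normSign_of_not_isNorm σ hcn
  have hω1 : normSign σ (1 : K) = 1 := normSign_one σ
  -- membership letters (★ corner lemma at `s = 0`, corner depth `e`, lineariser `1∕f`)
  have hV0 : (V : Matrix (Fin 3) (Fin 3) K) = !![1, 0, 0; x, ϖ ^ ρ, 0; x * ζ + f * (x * ζ), ϖ ^ ρ * ζ, ϖ ^ (2 * ρ + 0 + e)] := by rw [Nat.add_zero]; exact hV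
  have key : ∀ {u : Fin 3 → Kˣ}, u ∈ fixedUnitTorus σ 3 →
      Valued.v (((u 2 : Kˣ) : K) - u 1) ≤ Valued.v ϖ ^ (ρ + e) → Valued.v (f⁻¹ * (((u 2 : Kˣ) : K) - u 1) + (((u 2 : Kˣ) : K) - u 0)) ≤ Valued.v ϖ ^ (2 * ρ + e) →
        u ∈ fixedUnitStabilizer σ (latt (V : Matrix (Fin 3) (Fin 3) K)) := fun {u} huT h21 h20 =>
    (mem_fixedUnitStabilizer_latt_glued_corner_iff (σ := σ) hϖ0 hϖ1 ρ 0 e (x := x) (ζ := ζ) (y'' := f * (x * ζ)) (g := f⁻¹) hx hζ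
      (by rw [pow_zero, map_mul, map_mul, hf, hx, hζ, one_mul, one_mul]) (by rw [pow_zero, mul_one, map_inv₀, hf, inv_one])
      (by rw [show x * ζ - f⁻¹ * (f * (x * ζ)) = 0 by rw [← mul_assoc, inv_mul_cancel₀ hf0, one_mul, sub_self], map_zero]; exact zero_le) V hV0 huT).2 ⟨by rw [Nat.add_zero]; exact h21, h20⟩
  -- a unit builder
  have mkU : ∀ a : K, Valued.v a = 1 → ∃ au : Kˣ, (au : K) = a := fun a ha =>
    ⟨Units.mk0 a (fun h => by rw [h, map_zero] at ha; exact zero_ne_one ha), rfl⟩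
  fin_cases i
  · -- i = 0: u = (1 + (1 − c)∕f, c, 1), χ_0(u) = ω(c)ω(1) = −1
    set a : K := 1 + f⁻¹ * (1 - c) with ha
    have hσa : σ a = a := by rw [ha, map_add, map_one, map_mul, map_inv₀, hσf, map_sub, map_one, hσc]
    have hsm : Valued.v (f⁻¹ * (1 - c)) < 1 := by rw [map_mul, map_inv₀, hf, inv_one, one_mul]; exact hclt
    have hva : Valued.v a = 1 := by rw [ha, Valuation.map_add_eq_of_lt_left _ (by rwa [map_one]), map_one]
    obtain ⟨au, hau⟩ := mkU a hva
    obtain ⟨cu, hcu⟩ := mkU c hc1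
    refine ⟨![au, cu, 1], key ?_ ?_ ?_, ?_⟩
    · rw [mem_fixedUnitTorus_iff]
      refine ⟨fun j => ?_, fun j => ?_⟩ <;> fin_cases j
      · show Valued.v (au : K) = 1; rw [hau]; exact hva
      · show Valued.v (cu : K) = 1; rw [hcu]; exact hc1
      · show Valued.v ((1 : Kˣ) : K) = 1; rw [Units.val_one, map_one]
      · show σ (au : K) = au; rw [hau]; exact hσa
      · show σ (cu : K) = cu; rw [hcu]; exact hσc
      · show σ ((1 : Kˣ) : K) = (1 : Kˣ); rw [Units.val_one, map_one]
    · show Valued.v (((1 : Kˣ) : K) - cu) ≤ _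
      rw [Units.val_one, hcu]; exact hc1ρ
    · show Valued.v (f⁻¹ * (((1 : Kˣ) : K) - cu) + (((1 : Kˣ) : K) - au)) ≤ _
      rw [Units.val_one, hcu, hau, ha, show f⁻¹ * (1 - c) + (1 - (1 + f⁻¹ * (1 - c))) = 0 by ring, map_zero]; exact zero_le
    · rw [chiVec_apply]
      show normSign σ (cu : K) * normSign σ ((1 : Kˣ) : K) ≠ 1
      rw [hcu, Units.val_one, hωc, hω1]; norm_num
  · -- i = 1: u = (c, 1 + f(1 − c), 1), χ_1(u) = ω(c)ω(1) = −1
    set a : K := 1 + f * (1 - c) with ha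
    have hσa : σ a = a := by rw [ha, map_add, map_one, map_mul, hσf, map_sub, map_one, hσc]
    have hsm : Valued.v (f * (1 - c)) ≤ Valued.v ϖ ^ (ρ + e) := by rw [map_mul, hf, one_mul]; exact hc1ρ
    have hva : Valued.v a = 1 := by
      have hlt : Valued.v (f * (1 - c)) < 1 := by rw [map_mul, hf, one_mul]; exact hclt
      rw [ha, Valuation.map_add_eq_of_lt_left _ (by rwa [map_one]), map_one]
    obtain ⟨au, hau⟩ := mkU a hva
    obtain ⟨cu, hcu⟩ := mkU c hc1
    refine ⟨![cu, au, 1], key ?_ ?_ ?_, ?_⟩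
    · rw [mem_fixedUnitTorus_iff]
      refine ⟨fun j => ?_, fun j => ?_⟩ <;> fin_cases j
      · show Valued.v (cu : K) = 1; rw [hcu]; exact hc1
      · show Valued.v (au : K) = 1; rw [hau]; exact hva
      · show Valued.v ((1 : Kˣ) : K) = 1; rw [Units.val_one, map_one]
      · show σ (cu : K) = cu; rw [hcu]; exact hσc
      · show σ (au : K) = au; rw [hau]; exact hσa
      · show σ ((1 : Kˣ) : K) = (1 : Kˣ); rw [Units.val_one, map_one]
    · show Valued.v (((1 : Kˣ) : K) - au) ≤ _
      rw [Units.val_one, hau, ha, show (1 : K) - (1 + f * (1 - c)) = -(f * (1 - c)) by ring, Valuation.map_neg]; exact hsm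
    · show Valued.v (f⁻¹ * (((1 : Kˣ) : K) - au) + (((1 : Kˣ) : K) - cu)) ≤ _
      rw [Units.val_one, hcu, hau, ha, show f⁻¹ * (1 - (1 + f * (1 - c))) + (1 - c) = 0 by field_simp; ring, map_zero]; exact zero_le
    · rw [chiVec_apply]
      show normSign σ (cu : K) * normSign σ ((1 : Kˣ) : K) ≠ 1
      rw [hcu, Units.val_one, hωc, hω1]; norm_num
  · -- i = 2: u = (1 − t∕f, 1 + t, 1), t = (1 − c)∕(1∕f + c): u₀∕u₁ = c, so χ_2(u) = ω(u₀)ω(u₁) = ω(c·u₁)ω(u₁) = −1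
    have hgc : Valued.v (f⁻¹ + c) = 1 := by
      have e : f⁻¹ + c = f⁻¹ * (1 + f) + (c - 1) := by field_simp; ring
      have h1 : Valued.v (f⁻¹ * (1 + f)) = 1 := by rw [map_mul, map_inv₀, hf, inv_one, one_mul, h1f]
      have hlt : Valued.v (c - 1) < 1 := by rw [← neg_sub, Valuation.map_neg]; exact hclt
      rw [e, Valuation.map_add_eq_of_lt_left _ (by rwa [h1]), h1]
    have hgc0 : f⁻¹ + c ≠ 0 := fun h => by rw [h, map_zero] at hgc; exact zero_ne_one hgc
    set τ : K := (1 - c) / (f⁻¹ + c) with hτ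
    have hστ : σ τ = τ := by rw [hτ, map_div₀, map_sub, map_one, hσc, map_add, map_inv₀, hσf, hσc]
    have hvτ : Valued.v τ ≤ Valued.v ϖ ^ (ρ + e) := by rw [hτ, map_div₀, hgc, div_one]; exact hc1ρ
    have hvτ1 : Valued.v τ < 1 := by rw [hτ, map_div₀, hgc, div_one]; exact hclt
    set a₁ : K := 1 + τ with ha₁
    set a₀ : K := 1 - f⁻¹ * τ with ha₀
    have hσa₁ : σ a₁ = a₁ := by rw [ha₁, map_add, map_one, hστ]
    have hσa₀ : σ a₀ = a₀ := by rw [ha₀, map_sub, map_one, map_mul, map_inv₀, hσf, hστ]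
    have hva₁ : Valued.v a₁ = 1 := by rw [ha₁, Valuation.map_add_eq_of_lt_left _ (by rwa [map_one]), map_one]
    have hva₀ : Valued.v a₀ = 1 := by
      have hlt : Valued.v (-(f⁻¹ * τ)) < 1 := by rw [Valuation.map_neg, map_mul, map_inv₀, hf, inv_one, one_mul]; exact hvτ1
      rw [ha₀, sub_eq_add_neg, Valuation.map_add_eq_of_lt_left _ (by rwa [map_one]), map_one]
    have hratio : a₀ = c * a₁ := by
      have hτm : τ * (f⁻¹ + c) = 1 - c := by rw [hτ, div_mul_cancel₀ _ hgc0]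
      rw [ha₀, ha₁]; linear_combination -hτm
    obtain ⟨au₀, hau₀⟩ := mkU a₀ hva₀
    obtain ⟨au₁, hau₁⟩ := mkU a₁ hva₁
    have ha₁0 : a₁ ≠ 0 := fun h => by rw [h, map_zero] at hva₁; exact zero_ne_one hva₁
    refine ⟨![au₀, au₁, 1], key ?_ ?_ ?_, ?_⟩
    · rw [mem_fixedUnitTorus_iff]
      refine ⟨fun j => ?_, fun j => ?_⟩ <;> fin_cases j
      · show Valued.v (au₀ : K) = 1; rw [hau₀]; exact hva₀
      · show Valued.v (au₁ : K) = 1; rw [hau₁]; exact hva₁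
      · show Valued.v ((1 : Kˣ) : K) = 1; rw [Units.val_one, map_one]
      · show σ (au₀ : K) = au₀; rw [hau₀]; exact hσa₀
      · show σ (au₁ : K) = au₁; rw [hau₁]; exact hσa₁
      · show σ ((1 : Kˣ) : K) = (1 : Kˣ); rw [Units.val_one, map_one]
    · show Valued.v (((1 : Kˣ) : K) - au₁) ≤ _
      rw [Units.val_one, hau₁, ha₁, show (1 : K) - (1 + τ) = -τ by ring, Valuation.map_neg]; exact hvτ
    · show Valued.v (f⁻¹ * (((1 : Kˣ) : K) - au₁) + (((1 : Kˣ) : K) - au₀)) ≤ _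
      rw [Units.val_one, hau₁, hau₀, ha₁, ha₀, show f⁻¹ * (1 - (1 + τ)) + (1 - (1 - f⁻¹ * τ)) = 0 by ring, map_zero]; exact zero_le
    · rw [chiVec_apply]
      show normSign σ (au₀ : K) * normSign σ (au₁ : K) ≠ 1
      rw [hau₀, hau₁, hratio, normSign_mul_eq_neg_of_not_norm hD hσc hcn hσa₁ ha₁0, neg_mul, normSign_mul_self σ a₁]
      norm_num

end Summit.HodgeConjecture.HodgeConjecture.Cruxes.H413.F0P3cDyRamDiagonalKappaCoreHangingCornerWindow

end
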